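import Literature.Analysis.FluidPDE.KNSSLemma31Homogeneous
import Literature.Analysis.FluidPDE.KNSSWeakDriftMild
import Literature.Analysis.UnboundedOperators.HeatKernelBoundedData
import Mathlib.MeasureTheory.Function.Floor
import HarnessLib

/-!
# KNSS 2009, Lemma 3.1: discharge of the homogeneous case and of the drift-mild form

Discharges of the named facts `Literature.Analysis.FluidPDE.KNSS2009_lemma31_homogeneous`
(`KNSSWeakDriftMild.lean`) and, through the proved reduction
`KNSS2009_weak_driftMild_of_lemma31_homogeneous` of that file,
`Literature.Analysis.FluidPDE.KNSS2009_weak_driftMild` (`KNSSRegularityDecomposition.lean`):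
Koch–Nadirashvili–Seregin–Šverák, *Liouville theorems for the Navier–Stokes equations and
applications*, Acta Math. **203** (2009) 83–105 = arXiv:0709.3599v1, §3 Lemma 3.1 with
(3.17)–(3.18) (p. 7) and §4 (ii) (p. 8).

* `KNSS2009_lemma31_homogeneous_holds` — from the two-time identity of the duality proof
  (`exists_ae_eq_heatExtension_add_const_of_weakStokes`, `KNSSLemma31Homogeneous.lean`: off a
  null set `(0,T) ∖ G` of times, `z(t) = e^{(t−s)Δ}z(s) + β(s,t)` a.e.), by **gluing**: with base
  times `σₖ ∈ G`, `σₖ < T/(k+1)`, and a fixed normed bump `χ`, the fields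
  `F_k(t) = e^{(t−σₖ)Δ}z(σₖ) − ∫ χ e^{(T−σₖ)Δ}z(σₖ)` (`t > σₖ`) do not depend on `k` (two base times
  differ by a caloric extension and a constant, which the normalisation removes), so
  `w(t) = F_{⌈T/t⌉}(t)` is caloric in the semigroup sense, jointly measurable, bounded by `2Z`;
  `b(t) = ∫ χ (z(t) − w(t))` is the a.e. constant value of `z(t) − w(t)`, made measurable and
  truncated to the ball of radius `3Z`. Constants: `C(T) = 3` in (3.17)–(3.18).
* `KNSS2009_weak_driftMild_holds : KNSS2009_weak_driftMild`.

## References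

* [KochNadirashviliSereginSverak2009] H. Koch, N. Nadirashvili, G. Seregin, V. Šverák, Acta Math.
  203 (2009) 83–105, doi:10.1007/s11511-009-0039-6, arXiv:0709.3599 — §3 Lemma 3.1, (3.17)–(3.18),
  Remark 3.1 (p. 7); §4 (ii) (p. 8).
-/

open MeasureTheory TopologicalSpace Set Function Filter Topology InnerProductSpace Metric
open scoped RealInnerProductSpace ENNReal NNReal ContDiff Laplacian

noncomputable section

namespace Literature.Analysis.FluidPDE

variable {E : Type*} [NormedAddCommGroup E] [InnerProductSpace ℝ E] [FiniteDimensional ℝ E]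
  [MeasurableSpace E] [BorelSpace E]

/-- **KNSS 2009, Lemma 3.1, homogeneous case — discharged** (with `C(T) = 3` in (3.17)–(3.18)).
See the module docstring for the gluing of the two-time identity
`exists_ae_eq_heatExtension_add_const_of_weakStokes` into a single caloric field `w` and a bounded
measurable `b`. [cite: KochNadirashviliSereginSverak2009, Lemma 3.1 (case f = 0) with (3.17)–(3.18) (arXiv:0709.3599v1 p. 7)] -/
theorem KNSS2009_lemma31_homogeneous_holds : KNSS2009_lemma31_homogeneous E := by
  classical
  haveI : CompleteSpace E := FiniteDimensional.complete ℝ E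
  haveI : Nonempty E := ⟨0⟩
  intro T hT
  refine ⟨3, fun Z z hzm hZ hdiv hweak => ?_⟩
  have hZnn : 0 ≤ Z := (norm_nonneg _).trans (hZ (T / 2) ⟨by positivity, by linarith⟩ 0)
  rcases hZnn.eq_or_lt with hZ0 | hZ0
  · -- degenerate bound: `z = 0` on the slab
    subst hZ0
    have hz0 : ∀ t ∈ Ioo 0 T, ∀ x, z t x = 0 := fun t ht x => norm_le_zero_iff.1 (hZ t ht x)
    refine ⟨fun _ _ => 0, fun _ => 0, measurable_const, fun s t _ hst _ x => ?_, fun t _ x => by simp,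
      measurable_const, fun t => by simp, ?_⟩
    · exact (UnboundedOperators.heatExtension_const (0 : E) (sub_pos.2 hst) x).symm
    · filter_upwards [ae_restrict_mem measurableSet_Ioo] with t ht
      exact Eventually.of_forall fun x => by simp [hz0 t ht x]
  -- the two-time identity off a null set of times
  obtain ⟨G, hGsub, hGnull, hGm, hGdiv, htwo⟩ :=
    exists_ae_eq_heatExtension_add_const_of_weakStokes hzm hZ hdiv hweak
  choose! β hβ using htwo
  have hGae : ∀ᵐ t ∂(volume.restrict (Ioo 0 T)), t ∈ G := by
    refine (ae_restrict_iff' measurableSet_Ioo).2 ?_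
    rw [ae_iff]
    have e : {a : ℝ | ¬(a ∈ Ioo 0 T → a ∈ G)} = Ioo 0 T \ G := by
      ext a
      exact ⟨fun h => ⟨(Classical.not_imp.1 h).1, (Classical.not_imp.1 h).2⟩,
        fun h h' => h.2 (h' h.1)⟩
    rw [e]
    exact hGnull
  have hzM : ∀ s ∈ G, MemLp (z s) ∞ (volume : Measure E) := fun s hs =>
    memLp_top_of_bound (hGm s hs) Z (Eventually.of_forall (hZ s (hGsub hs)))
  have hHb : ∀ s ∈ G, ∀ τ : ℝ, 0 < τ → ∀ x, ‖UnboundedOperators.heatExtension (z s) τ x‖ ≤ Z :=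
    fun s hs τ hτ => UnboundedOperators.norm_heatExtension_le (hZ s (hGsub hs)) hτ
  have hHM : ∀ s ∈ G, ∀ τ : ℝ, 0 < τ → MemLp (UnboundedOperators.heatExtension (z s) τ) ∞
      (volume : Measure E) := fun s hs τ hτ =>
    memLp_top_of_bound (UnboundedOperators.contDiff_heatExtension_holds (hzM s hs) le_top
      hτ).continuous.aestronglyMeasurable Z (Eventually.of_forall (hHb s hs τ hτ))
  -- base times `σ k ∈ G`, `σ k < T / (k + 1)`
  have hGne : ∀ ε : ℝ, 0 < ε → ε ≤ T → ∃ s ∈ G, s < ε := by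
    intro ε hε hεT
    by_contra h
    simp only [not_exists, not_and, not_lt] at h
    have hsub : Ioo 0 ε ⊆ Ioo 0 T \ G := fun s hs =>
      ⟨⟨hs.1, hs.2.trans_le hεT⟩, fun hsG => not_lt.2 (h s hsG) hs.2⟩
    have h0 := measure_mono_null hsub hGnull
    rw [Real.volume_Ioo, ENNReal.ofReal_eq_zero, sub_zero] at h0
    exact not_lt.2 h0 hε
  have hσex : ∀ k : ℕ, ∃ s ∈ G, s < T / ((k : ℝ) + 1) := fun k =>
    hGne _ (by positivity) (div_le_self hT.le (le_add_of_nonneg_left k.cast_nonneg))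
  choose σ hσG hσlt using hσex
  have hσT : ∀ k, σ k < T := fun k => (hGsub (hσG k)).2
  -- the index selector `n t = ⌈T / t⌉`
  set n : ℝ → ℕ := fun t => ⌈T / t⌉₊ with hn_def
  have hnσ : ∀ t : ℝ, 0 < t → σ (n t) < t := by
    intro t ht
    refine (hσlt (n t)).trans_le ?_
    rw [div_le_iff₀ (by positivity)]
    calc T = t * (T / t) := by field_simp
      _ ≤ t * (⌈T / t⌉₊ : ℝ) := mul_le_mul_of_nonneg_left (Nat.le_ceil _) ht.le
      _ ≤ t * ((n t : ℝ) + 1) := mul_le_mul_of_nonneg_left (by simp [hn_def]) ht.le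
  -- the normalising bump
  set χB : ContDiffBump (0 : E) := ⟨1, 2, one_pos, one_lt_two⟩
  set χ : E → ℝ := χB.normed volume with hχ_def
  have hχnn : ∀ y, 0 ≤ χ y := fun y => χB.nonneg_normed y
  have hχint : ∫ y, χ y = 1 := χB.integral_normed
  have hχi : Integrable χ := χB.integrable_normed
  have hχc : Continuous χ := χB.continuous_normed
  have hav : ∀ {f : E → E} {B : ℝ}, (∀ y, ‖f y‖ ≤ B) → ‖∫ y, χ y • f y‖ ≤ B := by
    intro f B hfB
    calc ‖∫ y, χ y • f y‖ ≤ ∫ y, χ y * B :=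
          norm_integral_le_of_norm_le (hχi.mul_const B) (Eventually.of_forall fun y => by
            rw [norm_smul, Real.norm_of_nonneg (hχnn y)]
            exact mul_le_mul_of_nonneg_left (hfB y) (hχnn y))
      _ = B := by rw [integral_mul_const, hχint, one_mul]
  have havc : ∀ {f : E → E}, MemLp f ∞ (volume : Measure E) → ∀ c : E,
      ∫ y, χ y • (f y + c) = (∫ y, χ y • f y) + c := by
    intro f hf c
    have i1 : Integrable (fun y => χ y • f y) := hχi.smul_of_top_left hf
    have i2 : Integrable (fun y => χ y • c) := hχi.smul_const c
    simp_rw [smul_add]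
    rw [integral_add i1 i2, integral_smul_const, hχint, one_smul]
  -- normalising constants and the glued caloric field
  set κ : ℕ → E := fun k =>
    ∫ y, χ y • UnboundedOperators.heatExtension (z (σ k)) (T - σ k) y with hκ_def
  have hκb : ∀ k, ‖κ k‖ ≤ Z := fun k => hav (hHb _ (hσG k) _ (sub_pos.2 (hσT k)))
  set Fk : ℕ → ℝ × E → E := fun k =>
    {q : ℝ × E | σ k < q.1}.piecewise
      (fun q => UnboundedOperators.heatExtension (z (σ k)) (q.1 - σ k) q.2 - κ k) 0 with hFk_def
  have hFk_of_lt : ∀ k t x, σ k < t →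
      Fk k (t, x) = UnboundedOperators.heatExtension (z (σ k)) (t - σ k) x - κ k :=
    fun k t x h => Set.piecewise_eq_of_mem _ _ _ (show (t, x) ∈ {q : ℝ × E | σ k < q.1} from h)
  have hFk_meas : ∀ k, Measurable (Fk k) := by
    intro k
    refine ContinuousOn.measurable_piecewise ?_ continuousOn_const
      (measurableSet_lt measurable_const measurable_fst)
    have hc := UnboundedOperators.continuousOn_uncurry_heatExtension_of_memLp (hzM _ (hσG k)) le_top
    exact (hc.comp ((continuous_fst.sub continuous_const).prodMk continuous_snd).continuousOn
      (fun q hq => mem_prod.2 ⟨mem_Ioi.2 (sub_pos.2 hq), mem_univ _⟩)).sub continuousOn_const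
  -- independence of the base time
  have hext : ∀ j k, σ j < σ k → ∀ τ : ℝ, 0 < τ → ∀ y,
      UnboundedOperators.heatExtension (z (σ k)) τ y =
        UnboundedOperators.heatExtension (z (σ j)) (σ k - σ j + τ) y + β (σ j) (σ k) := by
    intro j k hjk τ hτ y
    have hδ : 0 < σ k - σ j := sub_pos.2 hjk
    rw [heatExtension_eq_of_ae_eq (hβ (σ j) (hσG j) (σ k) (hσG k) hjk) τ]
    have e1 : (fun y => UnboundedOperators.heatExtension (z (σ j)) (σ k - σ j) y + β (σ j) (σ k)) =
        UnboundedOperators.heatExtension (z (σ j)) (σ k - σ j) + fun _ => β (σ j) (σ k) := rfl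
    rw [e1, heatExtension_add_eq_of_memLp (hHM _ (hσG j) _ hδ) (memLp_top_const _) le_top hτ,
      Pi.add_apply, UnboundedOperators.heatExtension_const _ hτ,
      UnboundedOperators.heatExtension_add_holds (hzM _ (hσG j)) le_top hδ hτ]
  have hκjk : ∀ j k, σ j < σ k → κ k = κ j + β (σ j) (σ k) := by
    intro j k hjk
    have hTk : 0 < T - σ k := sub_pos.2 (hσT k)
    show (∫ y, χ y • UnboundedOperators.heatExtension (z (σ k)) (T - σ k) y) =
      (∫ y, χ y • UnboundedOperators.heatExtension (z (σ j)) (T - σ j) y) + β (σ j) (σ k)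
    simp_rw [hext j k hjk (T - σ k) hTk, show σ k - σ j + (T - σ k) = T - σ j by ring]
    exact havc (hHM _ (hσG j) _ (sub_pos.2 (hσT j))) _
  have hindep : ∀ j k t x, σ j < t → σ k < t → Fk j (t, x) = Fk k (t, x) := by
    suffices H : ∀ j k t x, σ j < σ k → σ k < t → Fk j (t, x) = Fk k (t, x) by
      intro j k t x hj hk
      rcases lt_trichotomy (σ j) (σ k) with h | h | h
      · exact H j k t x h hk
      · rw [hFk_of_lt j t x hj, hFk_of_lt k t x hk]
        simp only [hκ_def, h]
      · exact (H k j t x h hj).symm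
    intro j k t x hjk hkt
    rw [hFk_of_lt j t x (hjk.trans hkt), hFk_of_lt k t x hkt, hext j k hjk (t - σ k) (sub_pos.2 hkt) x,
      hκjk j k hjk, show σ k - σ j + (t - σ k) = t - σ j by ring]
    abel
  set w : ℝ → E → E := fun t x => Fk (n t) (t, x) with hw_def
  have hw_of : ∀ t x, 0 < t → ∀ k, σ k < t →
      w t x = UnboundedOperators.heatExtension (z (σ k)) (t - σ k) x - κ k := fun t x ht k hk => by
    show Fk (n t) (t, x) = _
    rw [hindep (n t) k t x (hnσ t ht) hk, hFk_of_lt k t x hk]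
  have hw_meas : Measurable (uncurry w) := by
    have hF : Measurable fun q : (ℝ × E) × ℕ => Fk q.2 q.1 :=
      measurable_from_prod_countable_left fun k => hFk_meas k
    have hsel : Measurable fun q : ℝ × E => (q, n q.1) :=
      measurable_id.prodMk (Nat.measurable_ceil.comp (measurable_const.div measurable_fst))
    exact hF.comp hsel
  have hwb : ∀ t, 0 < t → ∀ x, ‖w t x‖ ≤ Z + Z := fun t ht x => by
    rw [hw_of t x ht (n t) (hnσ t ht)]
    exact (norm_sub_le _ _).trans (add_le_add (hHb _ (hσG _) _ (sub_pos.2 (hnσ t ht)) x) (hκb _))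
  -- the drift: bump average of `z − w`, made measurable and truncated
  set b₀ : ℝ → E := fun t => ∫ y, χ y • (z t y - w t y) with hb₀_def
  have hb₀m : AEStronglyMeasurable b₀ (volume.restrict (Ioo 0 T)) := by
    have h1 : AEStronglyMeasurable (fun q : ℝ × E => χ q.2 • (uncurry z q - uncurry w q))
        ((volume.restrict (Ioo 0 T)).prod (volume : Measure E)) :=
      (hχc.comp continuous_snd).aestronglyMeasurable.smul (hzm.sub hw_meas.aestronglyMeasurable)
    exact h1.integral_prod_right'
  set b₁ : ℝ → E := hb₀m.mk b₀ with hb₁_def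
  have hb₁m : Measurable b₁ := hb₀m.stronglyMeasurable_mk.measurable
  set b : ℝ → E := fun t => if ‖b₁ t‖ ≤ 3 * Z then b₁ t else 0 with hb_def
  have hbm : Measurable b :=
    Measurable.ite (measurableSet_le hb₁m.norm measurable_const) hb₁m measurable_const
  have hbb : ∀ t, ‖b t‖ ≤ 3 * Z := fun t => by
    simp only [hb_def]
    split_ifs with h
    · exact h
    · rw [norm_zero]; positivity
  refine ⟨w, b, hw_meas, fun s t hs hst _ x => ?_, fun t ht x => (hwb t ht.1 x).trans (by linarith),
    hbm, hbb, ?_⟩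
  · -- the semigroup law
    set k := n s with hk
    have hks : σ k < s := hnσ s hs
    have hkt : σ k < t := hks.trans hst
    have hδ : 0 < s - σ k := sub_pos.2 hks
    have hts : 0 < t - s := sub_pos.2 hst
    rw [hw_of t x (hs.trans hst) k hkt]
    have hws : w s = UnboundedOperators.heatExtension (z (σ k)) (s - σ k) - fun _ => κ k :=
      funext fun y => hw_of s y hs k hks
    rw [hws, heatExtension_sub_eq_of_memLp (hHM _ (hσG k) _ hδ) (memLp_top_const _) le_top hts,
      Pi.sub_apply, UnboundedOperators.heatExtension_const _ hts,
      UnboundedOperators.heatExtension_add_holds (hzM _ (hσG k)) le_top hδ hts,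
      show s - σ k + (t - s) = t - σ k by ring]
  · -- `z(t) = w(t) + b(t)` a.e., for a.e. `t`
    filter_upwards [hGae, ae_restrict_mem measurableSet_Ioo, hb₀m.ae_eq_mk] with t htG ht hb01
    set k := n t with hk
    have hkt : σ k < t := hnσ t ht.1
    have hid := hβ (σ k) (hσG k) t htG hkt
    set c : E := β (σ k) t + κ k with hc
    have hzw : ∀ᵐ y ∂(volume : Measure E), z t y - w t y = c := by
      filter_upwards [hid] with y hy
      rw [hy, hw_of t y ht.1 k hkt, hc]
      abel
    -- the average recovers the constant, which is within `3Z`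
    have hb₀t : b₀ t = c := by
      show (∫ y, χ y • (z t y - w t y)) = c
      rw [integral_congr_ae (hzw.mono fun y hy => show χ y • (z t y - w t y) = χ y • c by rw [hy]),
        integral_smul_const, hχint, one_smul]
    obtain ⟨y₀, hy₀⟩ := hzw.exists
    have hcb : ‖c‖ ≤ 3 * Z := by
      rw [← hy₀]
      exact (norm_sub_le _ _).trans (by linarith [hZ t ht y₀, hwb t ht.1 y₀])
    have hbt : b t = c := by
      have h1 : b₁ t = c := hb01.symm.trans hb₀t
      simp only [hb_def, h1, if_pos hcb]
    filter_upwards [hzw] with y hy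
    rw [hbt, ← hy]
    abel

/-- **KNSS 2009, Lemma 3.1 in drift-mild form — discharged**: every bounded weak Navier–Stokes
solution on `ℝ³ × (0, T)` is `u = U + b(t)` a.e. with `(U, b)` a drift-mild pair
(`IsKNSSDriftMild`), by `KNSS2009_weak_driftMild_of_lemma31_homogeneous` and
`KNSS2009_lemma31_homogeneous_holds`. [cite: KochNadirashviliSereginSverak2009, §3 Lemma 3.1 and §4 (ii) (arXiv:0709.3599v1 pp. 7–8)] -/
theorem KNSS2009_weak_driftMild_holds : KNSS2009_weak_driftMild :=
  KNSS2009_weak_driftMild_of_lemma31_homogeneous KNSS2009_lemma31_homogeneous_holds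

end Literature.Analysis.FluidPDE
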